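import Literature.Analysis.FluidPDE.CompressibleEulerPrimitiveForm
import Literature.MathematicalPhysics.KineticTheory.HardSphereEuler

/-!
# The hard-sphere Euler system in primitive variables, inside the band

Crux `Summit.AtomisticToContinuum.HydrodynamicLimit.Theses.ImplosionDichotomy.HydroLimitInBand`
(stmt-AtomisticToContinuum-9133), line `IdeatorOneSketch` (in-band entropy clock), registered stub
`stub_eulerPrimitiveInBand : EulerPrimitiveInBand` (R4 of the line card; landed here under the stub-added name `hsEuler_primitiveInBand` with the unfolded signature, step 2 of the Grönwall core: "Euler in
entropy variables" starts from the PRIMITIVE form of the classical solution).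

Inside the packing band `ρσ³ ≤ η₀` the hard-sphere pressure law `hsPressure σ ρ θ = ρθ Z(ρσ³)` agrees pointwise
with the monatomic-excess law `p = ρϑχ(ρ)` of ANY globally smooth `χ` with `χ(r) = Z(rσ³)` for `0 ≤ r`,
`rσ³ ≤ η₀`; hence a classical hard-sphere-Euler solution whose density stays in the band is a classical solution of
the conservation laws for `CompressibleEuler.EulerEOS.monatomicExcess χ f` (the two solution notions agree field by
field once the pressure functions are identified on each time slice), and the Literature equivalence
`CompressibleEuler.isClassicalEulerSolutionOn_iff_primitive` (Majda 1984, Ch. 1–2; Dafermos 2005, §3.3.6) puts it in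
primitive variables: continuity, Euler and internal-energy equations. The statement is the registered signature
verbatim (body of `EulerPrimitiveInBand` in `Cruxes/HydroLimitInBand/Lines/IdeatorOneSketch.lean`).

* `hsEuler_entropyVariable_identity` — the ENTROPY-VARIABLE IDENTITY (algebraic core of Yau's cancellation for this
  system, line card Step 2): given the primitive equations at a point and `p = ρθχ(ρ)`, `∂ log a = (c/ρ)∂ρ`,
  `c = χ + ρχ′`, one has `∂_sΛ·δU + Σ_k ∂_kΛ·δF_k = 0` for every primitive increment — the coefficient of every conserved
  one-body quantity in the entropy production vanishes. Pure polynomial identity (`field_simp; ring`).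
-/

noncomputable section

open MeasureTheory Filter Set Topology
open scoped ContDiff

namespace Summit.AtomisticToContinuum.HydrodynamicLimit.Theorems.HydroLimitInBandClock

open Literature.MathematicalPhysics.KineticTheory Literature.Analysis.FluidPDE
open Literature.Analysis.FluidPDE.CompressibleEuler

/-- **The hard-sphere Euler system in primitive variables, in band** (registered stub `stub_eulerPrimitiveInBand` of
line `IdeatorOneSketch`, crux 9133): for `η₀, σ > 0`, every globally smooth `χ` agreeing with `r ↦ Z(rσ³)` on the
visited packing range, and every classical hard-sphere-Euler solution on `[0,T)` with `ρσ³ ≤ η₀` throughout, the triple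
`(ρ, u, θ)` is a primitive-variable classical solution for the law `p = ρϑχ(ρ)`, `e = 3ϑ/2`.
[cite: Majda1984, Ch. 2 §2.1] -/
theorem hsEuler_primitiveInBand :
  ∀ (η₀ σ : ℝ), 0 < η₀ → 0 < σ →
  ∀ (χ f : ℝ → ℝ), ContDiff ℝ ((⊤ : ℕ∞) : WithTop ℕ∞) χ →
    (∀ r : ℝ, 0 ≤ r → r * σ ^ 3 ≤ η₀ → χ r = hsCompressibility (r * σ ^ 3)) →
  ∀ (T : ℝ) (ρ θ : ℝ → T3 → ℝ) (u : ℝ → T3 → V3), IsHardSphereEulerSolution σ T ρ u θ →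
    (∀ t ∈ Set.Ico 0 T, ∀ x, ρ t x * σ ^ 3 ≤ η₀) →
    CompressibleEuler.IsPrimitiveEulerSolutionOn (CompressibleEuler.EulerEOS.monatomicExcess χ f) (Set.Ico 0 T) ρ u θ := by
  intro η₀ σ _hη₀ _hσ χ f hχ hagree T ρ θ u hE hband
  -- the pressure functions agree on every time slice in the band
  have hp : ∀ t ∈ Set.Ico 0 T,
      (fun y => (EulerEOS.monatomicExcess χ f).p (ρ t y) (θ t y)) = fun y => hsPressure σ (ρ t y) (θ t y) := by
    intro t ht
    funext y
    show ρ t y * θ t y * χ (ρ t y) = ρ t y * θ t y * hsCompressibility (ρ t y * σ ^ 3)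
    rw [hagree (ρ t y) (hE.density_pos t ht y).le (hband t ht y)]
  -- the energy densities agree as space–time functions
  have he : (fun s y => ρ s y * (‖u s y‖ ^ 2 / 2 + (EulerEOS.monatomicExcess χ f).e (ρ s y) (θ s y))) =
      fun s y => totalEnergyDensity (ρ s y) (u s y) (θ s y) := by
    funext s y
    show ρ s y * (‖u s y‖ ^ 2 / 2 + 3 / 2 * θ s y) = ρ s y * (‖u s y‖ ^ 2 / 2 + 3 / 2 * θ s y)
    rfl
  have hcl : IsClassicalEulerSolutionOn (EulerEOS.monatomicExcess χ f) (Set.Ico 0 T) ρ u θ := by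
    refine ⟨hE.smooth_density, hE.smooth_velocity, hE.smooth_temperature, hE.density_pos,
      hE.temperature_pos, hE.mass, fun t ht x => ?_, fun t ht x => ?_⟩
    · rw [hp t ht]
      exact hE.momentum t ht x
    · have hflux : (fun y => (ρ t y * (‖u t y‖ ^ 2 / 2 + (EulerEOS.monatomicExcess χ f).e (ρ t y) (θ t y)) +
            (EulerEOS.monatomicExcess χ f).p (ρ t y) (θ t y)) • u t y) =
          fun y => (totalEnergyDensity (ρ t y) (u t y) (θ t y) + hsPressure σ (ρ t y) (θ t y)) • u t y := by
        funext y
        have h1 : ρ t y * (‖u t y‖ ^ 2 / 2 + (EulerEOS.monatomicExcess χ f).e (ρ t y) (θ t y)) =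
            totalEnergyDensity (ρ t y) (u t y) (θ t y) := congrFun (congrFun he t) y
        have h2 : (EulerEOS.monatomicExcess χ f).p (ρ t y) (θ t y) = hsPressure σ (ρ t y) (θ t y) :=
          congrFun (hp t ht) y
        rw [h1, h2]
      rw [he, hflux]
      exact hE.energy t ht x
  exact hcl.primitive (uniqueDiffOn_Ico 0 T) (contDiff_monatomicExcess_p hχ).contDiffOn
    contDiff_monatomicExcess_e.contDiffOn

/-! ## The entropy-variable identity (algebraic core of Yau's cancellation for the hard-sphere Euler system)

Step 2 of the line card, in primitive variables and as a POLYNOMIAL identity (no analysis): with the entropy variables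
`Λ = (Λ₀, Λ_j, Λ_e) = (log a − (3/2) log(2πθ) − |u|²/(2θ), u_j/θ, −1/θ)` of the local Gibbs reference, the thermodynamic
activity obeying `∂ log a = (c/ρ) ∂ρ` (`c = χ + ρχ′ = ∂(ρχ)/∂ρ`, Gibbs–Duhem for `p = ρθχ(ρ)`), and the flux increments
`δF_k` of the complete Euler system `F_k = (ρu_k, ρu_ku + p e_k, (E + p)u_k)`, `E = ρ(|u|²/2 + 3θ/2)`, along an arbitrary
primitive increment `(δρ, δu, δθ)` (conserved increments `δm = uδρ + ρδu`, `δE = (|u|²/2 + 3θ/2)δρ + ρu·δu + (3/2)ρδθ`,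
`δp = θcδρ + ρχδθ`), the primitive equations (continuity, Euler, temperature) imply
`∂_sΛ·δU + Σ_k ∂_kΛ·δF_k = 0` — i.e. `∂_sΛ_β + Σ_{k,α} ∂_kΛ_α ∂F_{kα}/∂U_β = 0` for every conserved component `β`: the
coefficient of every conserved one-body quantity in the entropy production VANISHES, which is what turns the linear part of
the window functional into a within-window commutator (line card Step 2). Checked by `field_simp; ring`; a deliberately
perturbed copy fails, so the check is not vacuous. -/

/-- **The entropy-variable identity for the hard-sphere Euler system (polynomial form).** See the section docstring.
Variables: `ρ, θ ≠ 0`, velocity `u`, `χ = Z(ρσ³)`, `dχ = χ′(ρ)`, time derivatives `ρt, ut, θt`, space derivatives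
`dρ k = ∂_kρ`, `du k j = ∂_ku_j`, `dθ k = ∂_kθ`; hypotheses = the primitive equations at one point. [folklore] -/
theorem hsEuler_entropyVariable_identity (ρ θ χ dχ ρt θt δρ δθ : ℝ) (u ut dρ dθ δu : Fin 3 → ℝ)
    (du : Fin 3 → Fin 3 → ℝ) (hρ : ρ ≠ 0) (hθ : θ ≠ 0)
    (hP1 : ρt = -(∑ k, u k * dρ k) - ρ * ∑ k, du k k)
    (hP2 : ∀ j, ut j = -(∑ k, u k * du k j) - ρ⁻¹ * (θ * (χ + ρ * dχ) * dρ j + ρ * χ * dθ j))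
    (hP3 : θt = -(∑ k, u k * dθ k) - 2 / 3 * θ * χ * ∑ k, du k k) :
    let c : ℝ := χ + ρ * dχ
    let p : ℝ := ρ * θ * χ
    let E : ℝ := ρ * ((∑ j, u j ^ 2) / 2 + 3 / 2 * θ)
    let L0t : ℝ := c / ρ * ρt - 3 / (2 * θ) * θt - (∑ j, u j * ut j) / θ + (∑ j, u j ^ 2) * θt / (2 * θ ^ 2)
    let L0 : Fin 3 → ℝ := fun k => c / ρ * dρ k - 3 / (2 * θ) * dθ k - (∑ j, u j * du k j) / θ +
      (∑ j, u j ^ 2) * dθ k / (2 * θ ^ 2)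
    let Ljt : Fin 3 → ℝ := fun j => ut j / θ - u j * θt / θ ^ 2
    let Lj : Fin 3 → Fin 3 → ℝ := fun k j => du k j / θ - u j * dθ k / θ ^ 2
    let Let : ℝ := θt / θ ^ 2
    let Le : Fin 3 → ℝ := fun k => dθ k / θ ^ 2
    let δm : Fin 3 → ℝ := fun j => u j * δρ + ρ * δu j
    let δE : ℝ := ((∑ j, u j ^ 2) / 2 + 3 / 2 * θ) * δρ + ρ * (∑ j, u j * δu j) + 3 / 2 * ρ * δθ
    let δp : ℝ := θ * c * δρ + ρ * χ * δθ
    let δF0 : Fin 3 → ℝ := fun k => u k * δρ + ρ * δu k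
    let δFm : Fin 3 → Fin 3 → ℝ := fun k j => u k * u j * δρ + ρ * (u j * δu k + u k * δu j) +
      (if k = j then δp else 0)
    let δFe : Fin 3 → ℝ := fun k => (E + p) * δu k + u k * (δE + δp)
    L0t * δρ + (∑ j, Ljt j * δm j) + Let * δE +
      ∑ k, (L0 k * δF0 k + (∑ j, Lj k j * δFm k j) + Le k * δFe k) = 0 := by
  intro c p E L0t L0 Ljt Lj Let Le δm δE δp δF0 δFm δFe
  simp only [L0t, L0, Ljt, Lj, Let, Le, δm, δE, δp, δF0, δFm, δFe, c, p, E, Fin.sum_univ_three,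
    Fin.isValue, Fin.reduceEq, if_true, if_false]
  simp only [Fin.sum_univ_three] at hP1 hP2 hP3
  have h20 := hP2 0
  have h21 := hP2 1
  have h22 := hP2 2
  rw [hP1, hP3, h20, h21, h22]
  field_simp
  ring

end Summit.AtomisticToContinuum.HydrodynamicLimit.Theorems.HydroLimitInBandClock

end
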